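import Summits.Parity.GeneralizedHardyLittlewood.Theorems.LeeYangFibresRelativeDimOneLowerDefs
import Literature.NumberTheory.Sieve.LinearEquationsInPrimesTwinSystem
import Literature.NumberTheory.Sieve.ParityWave0
import HarnessLib

/-!
# Route `LeeYangFibres`, crux `RelativeDimOne` (stmt-Parity-14113), line `translate-amplification`
# (decoupled form): hardness certificate `LowerRelativeDimOne → TwinPrimeConjecture`

The LOWER half `LowerRelativeDimOne` of the crux (`(1 − ε) β_∞𝔖 ≤ S + εN`, `…LowerDefs`) alone implies the
twin prime conjecture: specialised to the twin-prime system `n ↦ (n, n + 2)` (Green–Tao 2010, Example 1;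
tree dictionary `Literature.NumberTheory.Sieve.LinearEquationsInPrimesTwinSystem`: `‖Ψ‖_N ≤ 3`,
`β_∞([-N, N]) = N`, the von Mangoldt sum is `∑_{n=1}^{N} Λ(n)Λ(n+2)`, `𝔖 ≥ 1`) and the full box
`K = [-N, N]`, it gives `∑_{n ≤ N} Λ(n) Λ(n+2) ≥ N/2` for large `N` (`twinSum_ge_of_lowerRelativeDimOne`),
while without twin primes beyond `n₀` the same sum is `O(√N log N)` (`twinCorrelation_le_of_no_twinPrimes`
and Chebyshev's `ψ − θ ≤ C √x`; `twinPrimeConjecture_of_twinSum_ge`, the argument of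
`Theorems.LeeYangFibresRelativeDimOne.twinPrimeConjecture_of_relativeDimOne`, which uses only the lower
inequality of the crux). Consequently ATOM L of the line, `CoarseLowerHLSlack` (which amplifies to
`LowerRelativeDimOne`, `stub_lowerAmplification`), is twin-prime-hard, whereas ATOM U is
`UniformCharPNT`-hard (`GallagherBackwards.uniformCharPNT_of_coarseUpperHLSlack`).
-/

noncomputable section

open scoped BigOperators Classical Topology ArithmeticFunction.vonMangoldt Chebyshev
open Finset Filter MeasureTheory Literature.NumberTheory.Sieve

namespace Summit.Parity.GeneralizedHardyLittlewood.Cruxes.RelativeDimOne.TranslateAmplification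

/-- **`LowerRelativeDimOne ⟹ ∑_{n ≤ N} Λ(n) Λ(n+2) ≥ N/2` for all large `N`**: the lower half of the
crux with `t = 2`, `L = 3`, `ε = 1/4` on the twin-prime system and `K = [-N, N]`, where `β_∞ = N` and
`𝔖 ≥ 1`: `S ≥ (3/4) N𝔖 − N/4 ≥ N/2`. -/
theorem twinSum_ge_of_lowerRelativeDimOne (h : LowerRelativeDimOne) :
    ∃ N₁ : ℕ, ∀ N : ℕ, N₁ ≤ N → (N : ℝ) / 2 ≤ ∑ n ∈ Icc 1 N, Λ n * Λ (n + 2) := by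
  obtain ⟨N₀, hN₀⟩ := h 2 3 (by norm_num) (1 / 4) (by norm_num)
  refine ⟨max N₀ 2, fun N hN => ?_⟩
  have hN2 : 2 ≤ N := le_of_max_le_right hN
  have hconv : Convex ℝ (realBox 1 (N : ℝ)) := convex_Icc _ _
  have hb := hN₀ N (le_of_max_le_left hN) twinPrimeSystem isNondegenerateSystem_twinPrimeSystem.1
    (by exact_mod_cast affLinSize_twinPrimeSystem_le hN2) (realBox 1 N) hconv subset_rfl
  rw [vonMangoldtSum_twinPrimeSystem, archFactor_twinPrimeSystem] at hb
  have hS := one_le_singularProduct_twinPrimeSystem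
  have hN0 : (0 : ℝ) ≤ N := Nat.cast_nonneg N
  nlinarith [mul_nonneg hN0 (by linarith : (0 : ℝ) ≤ singularProduct twinPrimeSystem - 1)]

/-- The elementary contrapositive: if `∑_{n ≤ N} Λ(n)Λ(n+2) ≥ N/2` for all large `N`, there are
infinitely many twin primes. If twin primes were bounded by `n₀`, `twinCorrelation_le_of_no_twinPrimes` and
Chebyshev's `ψ − θ ≤ C√x` would bound the correlation by `log(N+2)(A + 2C√(N+2))` — writing `N + 2 = z⁴`,
`log(N+2) ≤ 4z`, the two bounds are incompatible once `z ≥ 16C + 8A + 3` (the argument of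
`Theorems.LeeYangFibresRelativeDimOne.twinPrimeConjecture_of_relativeDimOne`). -/
theorem twinPrimeConjecture_of_twinSum_ge
    (hlb : ∃ N₁ : ℕ, ∀ N : ℕ, N₁ ≤ N → (N : ℝ) / 2 ≤ ∑ n ∈ Icc 1 N, Λ n * Λ (n + 2)) :
    TwinPrimeConjecture := by
  by_contra hT
  unfold TwinPrimeConjecture at hT
  push Not at hT
  obtain ⟨n₀, hn₀⟩ := hT
  have hno : ∀ n, n₀ < n → ¬ (n.Prime ∧ (n + 2).Prime) := fun n hn h2 => hn₀ n hn h2.1 h2.2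
  obtain ⟨N₁, hN₁⟩ := hlb
  obtain ⟨C₀, hC₀⟩ := Chebyshev.psi_sub_theta_le_mul_sqrt
  set C := max C₀ 0 with hCdef
  have hC0 : 0 ≤ C := le_max_right _ _
  have hC : ∀ x : ℝ, 0 ≤ x → ψ x - θ x ≤ C * Real.sqrt x := fun x _ =>
    (hC₀ x).trans (mul_le_mul_of_nonneg_right (le_max_left _ _) (Real.sqrt_nonneg x))
  set A := ∑ n ∈ Icc 1 n₀, Λ n with hAdef
  have hA0 : 0 ≤ A := Finset.sum_nonneg fun _ _ => ArithmeticFunction.vonMangoldt_nonneg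
  -- the scale: `N + 2 = z⁴` with `z ≥ z₀ := 16 C + 8 A + 3`
  set z₀ : ℝ := 16 * C + 8 * A + 3 with hz₀
  have hz₀3 : 3 ≤ z₀ := by rw [hz₀]; linarith
  set N := max N₁ ⌈z₀ ^ 4⌉₊ with hNdef
  have hNN₁ : N₁ ≤ N := le_max_left _ _
  have hmax : ⌈z₀ ^ 4⌉₊ ≤ N := le_max_right _ _
  have hNz : z₀ ^ 4 ≤ N := (Nat.le_ceil _).trans (by exact_mod_cast hmax)
  have hN0 : (0 : ℝ) ≤ N := Nat.cast_nonneg N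
  set x : ℝ := (N : ℝ) + 2 with hx
  have hx0 : 0 < x := by rw [hx]; linarith
  set z : ℝ := Real.sqrt (Real.sqrt x) with hz
  have hz0 : 0 ≤ z := Real.sqrt_nonneg _
  have hz2 : z ^ 2 = Real.sqrt x := by rw [hz, Real.sq_sqrt (Real.sqrt_nonneg x)]
  have hz4 : z ^ 4 = x := by
    rw [show z ^ 4 = (z ^ 2) ^ 2 by ring, hz2, Real.sq_sqrt hx0.le]
  have hzz₀ : z₀ ≤ z := by
    by_contra hlt
    push Not at hlt
    have : z ^ 4 < z₀ ^ 4 := by gcongr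
    rw [hz4, hx] at this
    linarith
  have hz1 : 1 ≤ z := by linarith
  -- `log x = 4 log z ≤ 4 z`
  have hlog : Real.log x ≤ 4 * z := by
    have hzpos : 0 < z := by linarith
    rw [← hz4, Real.log_pow]
    have := Real.log_le_sub_one_of_pos hzpos
    push_cast
    linarith
  -- lower bound at `N`
  have hlow := hN₁ N hNN₁
  -- upper bound at `N`
  have hup := twinCorrelation_le_of_no_twinPrimes hno N
  have hψN : ψ N - θ N ≤ C * z ^ 2 := by
    refine (hC N hN0).trans (mul_le_mul_of_nonneg_left ?_ hC0)
    rw [hz2]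
    exact Real.sqrt_le_sqrt (by rw [hx]; linarith)
  have hcast : ((N + 2 : ℕ) : ℝ) = x := by rw [hx]; push_cast; ring
  have hψN2 : ψ x - θ x ≤ C * z ^ 2 := by
    have := hC x hx0.le
    rwa [hz2]
  rw [hcast, ← hx] at hup
  have hbig : ∑ n ∈ Icc 1 N, Λ n * Λ (n + 2) ≤ 4 * z * (A + 2 * (C * z ^ 2)) := by
    refine hup.trans ?_
    have hin : A + (ψ N - θ N) + (ψ x - θ x) ≤ A + 2 * (C * z ^ 2) := by linarith
    have hin0 : 0 ≤ A + (ψ N - θ N) + (ψ x - θ x) := by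
      have h1 := Chebyshev.theta_le_psi (N : ℝ)
      have h2 := Chebyshev.theta_le_psi x
      linarith
    calc Real.log x * _ ≤ 4 * z * _ := mul_le_mul_of_nonneg_right hlog hin0
      _ ≤ 4 * z * (A + 2 * (C * z ^ 2)) := mul_le_mul_of_nonneg_left hin (by linarith)
  -- combine: `N/2 = (z⁴ - 2)/2 ≤ 4 A z + 8 C z³`, impossible for `z ≥ z₀`
  have hNx : (N : ℝ) = z ^ 4 - 2 := by rw [hz4, hx]; ring
  rw [hNx] at hlow
  have key : z ^ 4 ≤ 8 * A * z + 16 * C * z ^ 3 + 2 := by linarith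
  have hz3 : z ≤ z ^ 3 := by
    have h' : 0 ≤ z * ((z - 1) * (z + 1)) := mul_nonneg hz0 (mul_nonneg (by linarith) (by linarith))
    linarith [h', show z * ((z - 1) * (z + 1)) = z ^ 3 - z by ring]
  have h5 : z₀ * z ^ 3 ≤ z ^ 4 := by
    have h' := mul_le_mul_of_nonneg_right hzz₀ (pow_nonneg hz0 3)
    linarith [h', show z * z ^ 3 = z ^ 4 by ring]
  rw [hz₀] at h5
  linarith [mul_nonneg hA0 (sub_nonneg.mpr hz3)]

/-- **Certificate: the LOWER half of the crux alone implies the twin prime conjecture** (registered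
`--supports` helper of stmt-Parity-14113, line `translate-amplification`): `LowerRelativeDimOne` gives
`∑_{n ≤ N} Λ(n)Λ(n+2) ≥ N/2` for large `N` (`twinSum_ge_of_lowerRelativeDimOne`), incompatible with finitely
many twin primes (`twinPrimeConjecture_of_twinSum_ge`). Hence ATOM L of the line (`CoarseLowerHLSlack`, which
amplifies to `LowerRelativeDimOne`) is twin-prime-hard. -/
theorem twinPrimeConjecture_of_lowerRelativeDimOne : LowerRelativeDimOne → TwinPrimeConjecture :=
  fun h => twinPrimeConjecture_of_twinSum_ge (twinSum_ge_of_lowerRelativeDimOne h)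

end Summit.Parity.GeneralizedHardyLittlewood.Cruxes.RelativeDimOne.TranslateAmplification
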